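import Mathlib
import HarnessLib
import Literature.AlgebraicGeometry.Ramification.InertiaNormalSylow
import Literature.AlgebraicGeometry.Resolution.ResolutionOfSingularities
import Literature.AlgebraicGeometry.Resolution.AlterationsResolution
import Summits.ResolutionOfSingularities.ResolutionOfSingularities.Theorems.WildQuotientsWildQuotientResolutionToralEndState

/-!
# REDUCTION: a toroidalised equivariant regular model IS a Phase-0 model
# (crux `WildQuotients.WildQuotientResolution`, stub `stub_phaseZeroHighDim`; any dimension)

Crux stmt-ResolutionOfSingularities-15640 (`WildQuotientResolution`), registered stub `stub_phaseZeroHighDim`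
(Phase 0: `∃ (Xs, π, ρs)`, proper birational, `Xs` integral REGULAR, `π` equivariant, EVERY INERTIA GROUP p-CLOSED,
`G`-stable affine cover). This file is the kernel-checked form of the reduction announced in the evidence memo
PHASE0-TAME-CENTRE-ORDER.md (E1)/(F): **if an equivariant regular model of the crux data reaches the TORAL END STATE
at every point** — for the stalk action of `I_x` there are first-order-stable boundary equations modulo which the
elements of order prime to `p` act trivially (✓`ToralEndState` p820081) — **then it satisfies every clause of the
conclusion of `stub_phaseZeroHighDim`**. The stub is thereby reduced, in every dimension, to the EXISTENCE of such a
model (R-B′: a terminating sequence of tame moves ✓`tameMove`/✓`tameOrbitMove`), a statement about tame subgroups and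
regular centres only. Faithfulness of the lifted action (needed by ✓`stalkAction_injective`) is derived here from the
faithfulness of `ρ`, equivariance and dominance of the birational `π`.

[OURS · crux stmt-ResolutionOfSingularities-15640 · helper toward `stub_phaseZeroHighDim` (reduction to R-B′; NOT a
proof of the stub); counted 0; AI-level work, weaker than expert review.]

* `injective_of_equivariant_isBirational` — the action lifted along an equivariant birational morphism onto an
  integral scheme separated over an invariant base is faithful;
* `phaseZero_of_toralModel` — the reduction.
-/

-- single-problem summit: the doubled namespace component `ResolutionOfSingularities` is forced
set_option linter.dupNamespace false

noncomputable section

namespace Summit.ResolutionOfSingularities.ResolutionOfSingularities.Theorems.WildQuotientResolution.InertLocusStalk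

open CategoryTheory AlgebraicGeometry TopologicalSpace IsLocalRing
open Literature.AlgebraicGeometry.Resolution Literature.AlgebraicGeometry.Ramification

/-- **Faithfulness lifts along equivariant birational morphisms**: if `ρ` acts faithfully on the integral `X′` over
the separated `s : X′ → Z` (`ρ g ≫ s = s`) and `π : X♯ → X′` is birational and equivariant for `ρ♯`, then `ρ♯` is
faithful (`ρ♯ g = 1 ⇒ π ≫ ρ g = π ⇒ ρ g = 1`, `π` dominant, Mathlib `ext_of_isDominant_of_isSeparated`). [folklore] -/
theorem injective_of_equivariant_isBirational {Xs X' Z : Scheme.{0}} [IsIntegral X'] [IsReduced Xs]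
    (s : X' ⟶ Z) [IsSeparated s] {G : Type} [Group G] (ρ : G →* Aut X') (hfaith : Function.Injective ρ)
    (hρ : ∀ g : G, (ρ g).hom ≫ s = s) (π : Xs ⟶ X') (hbir : IsBirational π) (ρs : G →* Aut Xs)
    (hequiv : ∀ g : G, (ρs g).hom ≫ π = π ≫ (ρ g).hom) : Function.Injective ρs := by
  haveI : IsDominant π := hbir.isDominant
  intro g₁ g₂ h
  rw [← inv_mul_eq_one]
  apply hfaith
  rw [map_one]
  have h1 : ρs (g₁⁻¹ * g₂) = 1 := by
    rw [map_mul, map_inv, inv_mul_eq_one]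
    exact h
  have h2 : π ≫ (ρ (g₁⁻¹ * g₂)).hom = π ≫ 𝟙 X' := by
    rw [Category.comp_id, ← hequiv, h1]
    exact Category.id_comp π
  have h3 : (ρ (g₁⁻¹ * g₂)).hom = 𝟙 X' :=
    ext_of_isDominant_of_isSeparated s (by rw [hρ, Category.id_comp]) π h2
  ext : 1
  exact h3

/-- **A toroidalised equivariant regular model is a Phase-0 model** (crux stmt-ResolutionOfSingularities-15640,
reduction of `stub_phaseZeroHighDim` to R-B′; any dimension). Crux data: `k` of characteristic `p`, `X₁/k` separated
of finite type, `X′` integral, `q : X′ → X₁` finite, `ρ` a faithful action of the finite `G` over `q`. Let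
`π : X♯ → X′` with `ρ♯` be an equivariant proper birational model, `X♯` integral and regular with a `G`-stable affine
cover, such that at EVERY point `x ∈ X♯` the toral end state holds: for the stalk action `(a, τ)` of `I_x` there are
`z₁, …, z_n ∈ 𝔪_x` with `(zᵢ) + 𝔪_x²` stable under `I_x` and every element of `I_x` of order prime to `p` trivial on
`𝔪_x/((z) + 𝔪_x²)`. Then `(X♯, π, ρ♯)` has all the properties demanded by `stub_phaseZeroHighDim`: in particular every
inertia group of `ρ♯` is p-closed (✓`hasNormalSylow_inertia_of_toralBoundary`). [folklore] -/
theorem phaseZero_of_toralModel (p : ℕ) (hp : p.Prime) (k : Type) [Field k] [CharP k p]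
    (X' X₁ : Scheme.{0}) (f : X₁ ⟶ Spec (.of k)) (q : X' ⟶ X₁) (G : Type) [Group G] [Finite G]
    (ρ : G →* Aut X') (hfaith : Function.Injective ρ)
    [IsSeparated f] [LocallyOfFiniteType f] [QuasiCompact f] [IsIntegral X'] [IsFinite q]
    (hρ : ∀ g : G, (ρ g).hom ≫ q = q)
    (Xs : Scheme.{0}) (π : Xs ⟶ X') (ρs : G →* Aut Xs) [IsProper π] (hbir : IsBirational π)
    [IsIntegral Xs] (hXsreg : Scheme.IsRegular Xs) (hequiv : ∀ g : G, (ρs g).hom ≫ π = π ≫ (ρ g).hom)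
    (hcov : ∀ x : Xs, ∃ U : Xs.Opens, IsAffineOpen U ∧ x ∈ U ∧ ∀ g : G, (ρs g).hom ⁻¹ᵁ U = U)
    (htor : ∀ (x : Xs) (a : inertiaSubgroup ρs x → (Xs.presheaf.stalk x ⟶ Xs.presheaf.stalk x))
      (τ : inertiaSubgroup ρs x →* (Xs.presheaf.stalk x ≃+* Xs.presheaf.stalk x)),
      (∀ g : inertiaSubgroup ρs x,
        Spec.map (a g) ≫ Xs.fromSpecStalk x = Xs.fromSpecStalk x ≫ (ρs (g : G)).hom) →
      (∀ (g : inertiaSubgroup ρs x) (s : Xs.presheaf.stalk x), τ g s = (a g⁻¹).hom s) →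
      ∃ (n : ℕ) (z : Fin n → Xs.presheaf.stalk x), (∀ i, z i ∈ maximalIdeal (Xs.presheaf.stalk x)) ∧
        (∀ (g : inertiaSubgroup ρs x) (i : Fin n),
          τ g (z i) ∈ Ideal.span {z i} ⊔ maximalIdeal (Xs.presheaf.stalk x) ^ 2) ∧
        (∀ g : inertiaSubgroup ρs x, (orderOf g).Coprime p → ∀ w ∈ maximalIdeal (Xs.presheaf.stalk x),
          τ g w - w ∈ Ideal.span (Set.range z) ⊔ maximalIdeal (Xs.presheaf.stalk x) ^ 2)) :
    ∃ (Xs : Scheme.{0}) (π : Xs ⟶ X') (ρs : G →* Aut Xs), IsProper π ∧ IsBirational π ∧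
      IsIntegral Xs ∧ Scheme.IsRegular Xs ∧ (∀ g : G, (ρs g).hom ≫ π = π ≫ (ρ g).hom) ∧
      (∀ x : Xs, HasNormalSylow p (inertiaSubgroup ρs x)) ∧
      ∀ x : Xs, ∃ U : Xs.Opens, IsAffineOpen U ∧ x ∈ U ∧ ∀ g : G, (ρs g).hom ⁻¹ᵁ U = U := by
  haveI : Fact p.Prime := ⟨hp⟩
  -- `X♯` is locally Noetherian (finite type over `k`) and separated over `X₁`
  haveI : IsLocallyNoetherian Xs := LocallyOfFiniteType.isLocallyNoetherian (π ≫ q ≫ f)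
  -- the lifted action is faithful and acts over the separated `π ≫ q`
  have hfaiths : Function.Injective ρs :=
    injective_of_equivariant_isBirational (q ≫ f) ρ hfaith
      (fun g => by rw [← Category.assoc, hρ g]) π hbir ρs hequiv
  have hρs : ∀ g : G, (ρs g).hom ≫ (π ≫ q) = π ≫ q := fun g => by
    rw [← Category.assoc, hequiv g, Category.assoc, hρ g]
  -- residue characteristics of `X♯`
  have hcharS : ∀ x : Xs, CharP (ResidueField (Xs.presheaf.stalk x)) p := fun x =>
    (((IsLocalRing.residue (Xs.presheaf.stalk x)).comp ((Xs.presheaf.germ ⊤ x trivial).hom.comp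
      (((π ≫ q ≫ f).appTop).hom.comp (Scheme.ΓSpecIso (.of k)).inv.hom))).charP_iff_charP p).mp
      inferInstance
  refine ⟨Xs, π, ρs, ‹IsProper π›, hbir, ‹IsIntegral Xs›, hXsreg, hequiv, fun x => ?_, hcov⟩
  haveI := hcharS x
  exact hasNormalSylow_inertia_of_toralBoundary ρs hfaiths (π ≫ q) hρs p x (htor x)

end Summit.ResolutionOfSingularities.ResolutionOfSingularities.Theorems.WildQuotientResolution.InertLocusStalk

end
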